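import Literature.NumberTheory.Automorphic.Zelevinsky1980.MaximalParabolicOrbitFiltration
import Literature.NumberTheory.Automorphic.OpenCellStandardSectionDecomposition
import Literature.NumberTheory.Automorphic.OpenCellCoinvariants
import HarnessLib

/-!
# R90-TF · S1 «Ch10-local» · split place, ROAD β — matrix bookkeeping for the open `Q_{2,1}`-orbit of `GL₃`

Cell `hodgecm-mathlib`, programme R90-TF, section S1, crux H413 (`stmt-HodgeConjecture-24833`), route `HCCMUnconditional`;
prover seat R90-C10-p02 (deal «S1 DEAL / EMIT S1 WAVE 1», socket S1#7 `SocketSplitInducedIrreducible`, second hand, ROAD β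
«by support of σ»).  THEOREMS ONLY (no `def`, no instance, no notation, no `sorry`); helper file for
`R90S1SplitOpenCellCoinvariantsVanish` (the `W`-valued open-orbit vanishing) — lane `--supports stmt-HodgeConjecture-24833`.

Let `F` be a field, `P = Q_{2,1} = standardParabolicGL F (lastBlockLabel 3) ≤ GL₃(F)`, `N' = oppositeCellRadical` (the
matrices `1 + y₁ E₀₁ + y₂ E₀₂`, so that `P w₀ N'` is the open `(P, N')`-cell, ★ `mem_parabolicDoubleCoset_rev_iff_apply_ne_zero`),
`u_{ij}(b) = transvectionGL i j b = 1 + b E_{ij}`.  We record: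

* §1 the identities `w₀ u₁₂(b) w₀⁻¹ = u₁₀(b)`, `x = u₀₁(x₀₁) u₀₂(x₀₂)` for `x ∈ N'`, `u₁₂(b) x = u₀₂(-x₀₁ b) x u₁₂(b)`,
  `u₁₂(b)⁻¹ x u₁₂(b) = u₀₁(x₀₁) u₀₂(x₀₂ + x₀₁ b)`, and the memberships `u₁₂(b), u₀₂(a) ∈ U_P`, `u₀ⱼ(a) ∈ N'`, `u₁₀(b) ∈ P`,
  `u₁₂(b) ∈ A'` (the unipotent part of the Levi of the reversed parabolic);
* §2 over a valued field: the LONG BOXES `K(γ, γ|t|⁻¹) = d_t K_γ d_t⁻¹ ≤ N'` (`d_t = diag(1,1,t)`, `K_γ = N' ∩ K_γ` the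
  congruence box): membership (`v(x₀₁) ≤ γ`, `v(x₀₂ t) ≤ γ`), `K_γ ≤ K(γ, γ|t|⁻¹)` for `v(t) ≤ 1`, coset representatives
  `u₀₂(a) ∈ U_P`, and normalisation by `u₁₂(b)` whenever `v(b t) ≤ 1`.

These are the coordinates of the open orbit in the geometric lemma for the pair `(Q_{2,1}, Q_{2,1})`
([BernsteinZelevinskyASENS1977, Thm. 5.2, §7.1]; [Casselman1995, Prop. 6.3.1–6.3.3]).
HONEST LABEL: bookkeeping only; HC_CM is proved only modulo the 7 printed citations (2 remaining named inputs:
hLiu418 = stmt-HodgeConjecture-24832, h413 = stmt-HodgeConjecture-24833) until rung 0 closes.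

## References
* [BernsteinZelevinskyASENS1977] I. N. Bernstein, A. V. Zelevinsky, *Induced representations of reductive p-adic groups I*,
  Ann. Sci. ÉNS 10 (1977), Thm. 5.2, §7.1.
* [Zelevinsky1980] A. V. Zelevinsky, *Induced representations of reductive p-adic groups II*, Ann. Sci. ÉNS 13 (1980), §1.1.
* [Casselman1995] W. Casselman, *Introduction to the theory of admissible representations of p-adic reductive groups* (1995),
  Prop. 6.3.1–6.3.3.
-/

set_option autoImplicit false
set_option linter.dupNamespace false

noncomputable section

open Matrix Literature.LinearAlgebra.Matrix.DiagonalTorus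
open Literature.NumberTheory.Automorphic Literature.NumberTheory.Automorphic.Zelevinsky1980
open ValuativeRel

namespace Summit.HodgeConjecture.HodgeConjecture.R90.S1.SplitCell

variable {F : Type*} [Field F]

/-! ## §1 Matrix bookkeeping in `GL₃`: the root elements `u_{ij}(b) = 1 + b E_{ij}` -/


/-- `w₀ u₁₂(b) w₀⁻¹ = u₁₀(b)`. [cite: BernsteinZelevinskyASENS1977, Thm. 5.2 and §7.1] -/
theorem w₀_conj_u12 (b : F) :
    permGL Fin.revPerm * transvectionGL (1 : Fin 3) 2 (show (1 : Fin 3) ≠ 2 by decide) b * (permGL Fin.revPerm)⁻¹ =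
      transvectionGL (1 : Fin 3) 0 (show (1 : Fin 3) ≠ 0 by decide) b := by
  rw [permGL_mul_transvectionGL_mul_inv]
  rfl

/-- An element of `N'` is `u₀₁(x₀₁) u₀₂(x₀₂)`. [cite: BernsteinZelevinskyASENS1977, §7.1] -/
theorem eq_u01_mul_u02_of_mem {x : GL (Fin 3) F}
    (hx : x ∈ oppositeCellRadical (K := F) (lastBlockLabel 3)) :
    x = transvectionGL (0 : Fin 3) 1 (show (0 : Fin 3) ≠ 1 by decide) ((x : Matrix (Fin 3) (Fin 3) F) 0 1) *
      transvectionGL (0 : Fin 3) 2 (show (0 : Fin 3) ≠ 2 by decide) ((x : Matrix (Fin 3) (Fin 3) F) 0 2) := by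
  have hx' := (mem_oppositeCellRadical_lastBlockLabel_iff x).1 hx
  have e00 : (x : Matrix (Fin 3) (Fin 3) F) 0 0 = 1 := by rw [hx' 0 0 (fun h => h.2 rfl), Matrix.one_apply_eq]
  have e10 : (x : Matrix (Fin 3) (Fin 3) F) 1 0 = 0 := by rw [hx' 1 0 (fun h => by simp at h)]; simp
  have e11 : (x : Matrix (Fin 3) (Fin 3) F) 1 1 = 1 := by rw [hx' 1 1 (fun h => by simp at h)]; simp
  have e12 : (x : Matrix (Fin 3) (Fin 3) F) 1 2 = 0 := by rw [hx' 1 2 (fun h => by simp at h)]; simp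
  have e20 : (x : Matrix (Fin 3) (Fin 3) F) 2 0 = 0 := by rw [hx' 2 0 (fun h => by simp at h)]; simp
  have e21 : (x : Matrix (Fin 3) (Fin 3) F) 2 1 = 0 := by rw [hx' 2 1 (fun h => by simp at h)]; simp
  have e22 : (x : Matrix (Fin 3) (Fin 3) F) 2 2 = 1 := by rw [hx' 2 2 (fun h => by simp at h)]; simp
  refine Units.ext ?_
  rw [Units.val_mul, coe_transvectionGL, coe_transvectionGL]
  ext i j
  fin_cases i <;> fin_cases j <;>
    simp [Matrix.transvection, Matrix.mul_apply, Fin.sum_univ_three, e00, e10, e11, e12, e20, e21, e22]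

/-- `u₁₂(b) · u₀₁(y₁) u₀₂(y₂) = u₀₂(-(y₁ b)) · u₀₁(y₁) u₀₂(y₂) · u₁₂(b)`. [cite: BernsteinZelevinskyASENS1977, §7.1] -/
theorem u12_mul_u01_mul_u02 (b y₁ y₂ : F) :
    transvectionGL (1 : Fin 3) 2 (show (1 : Fin 3) ≠ 2 by decide) b * (transvectionGL (0 : Fin 3) 1 (show (0 : Fin 3) ≠ 1 by decide) y₁ * transvectionGL (0 : Fin 3) 2 (show (0 : Fin 3) ≠ 2 by decide) y₂) =
      transvectionGL (0 : Fin 3) 2 (show (0 : Fin 3) ≠ 2 by decide) (-(y₁ * b)) * (transvectionGL (0 : Fin 3) 1 (show (0 : Fin 3) ≠ 1 by decide) y₁ * transvectionGL (0 : Fin 3) 2 (show (0 : Fin 3) ≠ 2 by decide) y₂) *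
        transvectionGL (1 : Fin 3) 2 (show (1 : Fin 3) ≠ 2 by decide) b := by
  refine Units.ext ?_
  simp only [Units.val_mul, coe_transvectionGL]
  ext i j
  fin_cases i <;> fin_cases j <;>
    simp [Matrix.transvection, Matrix.mul_apply, Fin.sum_univ_three, add_comm]

/-- `u₁₂(b)⁻¹ · u₀₁(y₁) u₀₂(y₂) · u₁₂(b) = u₀₁(y₁) u₀₂(y₂ + y₁ b)`. [cite: BernsteinZelevinskyASENS1977, §7.1] -/
theorem u12_inv_mul_u01_mul_u02_mul_u12 (b y₁ y₂ : F) :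
    (transvectionGL (1 : Fin 3) 2 (show (1 : Fin 3) ≠ 2 by decide) b)⁻¹ * (transvectionGL (0 : Fin 3) 1 (show (0 : Fin 3) ≠ 1 by decide) y₁ * transvectionGL (0 : Fin 3) 2 (show (0 : Fin 3) ≠ 2 by decide) y₂) *
        transvectionGL (1 : Fin 3) 2 (show (1 : Fin 3) ≠ 2 by decide) b =
      transvectionGL (0 : Fin 3) 1 (show (0 : Fin 3) ≠ 1 by decide) y₁ * transvectionGL (0 : Fin 3) 2 (show (0 : Fin 3) ≠ 2 by decide) (y₂ + y₁ * b) := by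
  rw [← transvectionGL_neg]
  refine Units.ext ?_
  simp only [Units.val_mul, coe_transvectionGL]
  ext i j
  fin_cases i <;> fin_cases j <;>
    simp [Matrix.transvection, Matrix.mul_apply, Fin.sum_univ_three, add_comm]


/-- `u₁₂(b)` lies in the unipotent radical `U_P` of `P = Q_{2,1}`. [cite: Zelevinsky1980, §1.1] -/
theorem u12_mem_unipotentRadicalGL (b : F) :
    transvectionGL (1 : Fin 3) 2 (show (1 : Fin 3) ≠ 2 by decide) b ∈ unipotentRadicalGL F (lastBlockLabel 3) :=
  transvectionGL_mem_unipotentRadicalGL (lastBlockLabel 3) (a := 1) (b := 2) (by decide) b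

/-- `u₀₂(a)` lies in the unipotent radical `U_P` of `P = Q_{2,1}`. [cite: Zelevinsky1980, §1.1] -/
theorem u02_mem_unipotentRadicalGL (a : F) :
    transvectionGL (0 : Fin 3) 2 (show (0 : Fin 3) ≠ 2 by decide) a ∈ unipotentRadicalGL F (lastBlockLabel 3) :=
  transvectionGL_mem_unipotentRadicalGL (lastBlockLabel 3) (a := 0) (b := 2) (by decide) a

/-- `u₀ⱼ(a) ∈ N'` for `j = 1, 2`. [cite: BernsteinZelevinskyASENS1977, §7.1] -/
theorem u0j_mem_oppositeCellRadical {j : Fin 3} (hj : (0 : Fin 3) ≠ j) (a : F) :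
    transvectionGL (0 : Fin 3) j hj a ∈ oppositeCellRadical (K := F) (lastBlockLabel 3) := by
  rw [mem_oppositeCellRadical_lastBlockLabel_iff]
  intro i k hik
  rw [coe_transvectionGL, Matrix.transvection, Matrix.add_apply, Matrix.single_apply_of_ne, add_zero]
  rintro ⟨rfl, rfl⟩
  exact hik ⟨rfl, fun h => hj (Fin.ext h.symm)⟩

/-- `u₁₀(b) ∈ P = Q_{2,1}` (it lies in the `GL₂` block of the Levi). [cite: Zelevinsky1980, §1.1] -/
theorem u10_mem_standardParabolicGL (b : F) :
    transvectionGL (1 : Fin 3) 0 (show (1 : Fin 3) ≠ 0 by decide) b ∈ standardParabolicGL F (lastBlockLabel 3) := by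
  refine (mem_standardParabolicGL_lastBlockLabel_iff (n := 1) _).2 fun j hj => ?_
  rw [coe_transvectionGL, Matrix.transvection, Matrix.add_apply, Matrix.single_apply_of_ne, add_zero,
    Matrix.one_apply_ne (Ne.symm hj)]
  rintro ⟨h, -⟩
  exact absurd h (by decide)

/-- `u₁₂(b)` lies in the reversed parabolic `P' = P_{(1,2)}`. [cite: BernsteinZelevinskyASENS1977, §7.1] -/
theorem u12_mem_reversedParabolic (b : F) :
    transvectionGL (1 : Fin 3) 2 (show (1 : Fin 3) ≠ 2 by decide) b ∈ standardParabolicGL F (⇑OrderDual.toDual ∘ revLabel (lastBlockLabel 3)) :=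
  upperUnitriangular_le_reversedParabolic (lastBlockLabel 3) (monotone_lastBlockLabel 3)
    (transvectionGL_mem_upperUnitriangular (show (1 : Fin 3) < 2 by decide) b)

/-- `u₁₂(b) ∈ A' = U₃ ∩ P_{revLabel}` (the unipotent part of the Levi of `P'`). [cite: BernsteinZelevinskyASENS1977, §7.1] -/
theorem u12_mem_cellLeviUnipotent (b : F) :
    transvectionGL (1 : Fin 3) 2 (show (1 : Fin 3) ≠ 2 by decide) b ∈ cellLeviUnipotent (K := F) (lastBlockLabel 3) :=
  (mem_cellLeviUnipotent_iff_conj_mem _ _).2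
    ⟨transvectionGL_mem_upperUnitriangular (show (1 : Fin 3) < 2 by decide) b,
      by rw [w₀_conj_u12]; exact u10_mem_standardParabolicGL b⟩

/-- `u₁₂(b) · x = u₀₂(-(x₀₁ b)) · x · u₁₂(b)` for `x ∈ N'`. [cite: BernsteinZelevinskyASENS1977, §7.1] -/
theorem u12_mul_of_mem {x : GL (Fin 3) F} (hx : x ∈ oppositeCellRadical (K := F) (lastBlockLabel 3)) (b : F) :
    transvectionGL (1 : Fin 3) 2 (show (1 : Fin 3) ≠ 2 by decide) b * x =
      transvectionGL (0 : Fin 3) 2 (show (0 : Fin 3) ≠ 2 by decide) (-((x : Matrix (Fin 3) (Fin 3) F) 0 1 * b)) * x *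
        transvectionGL (1 : Fin 3) 2 (show (1 : Fin 3) ≠ 2 by decide) b := by
  have e := eq_u01_mul_u02_of_mem hx
  have h := u12_mul_u01_mul_u02 b ((x : Matrix (Fin 3) (Fin 3) F) 0 1) ((x : Matrix (Fin 3) (Fin 3) F) 0 2)
  rw [← e] at h
  exact h

/-- For `x ∈ N'`: `u₁₂(b)⁻¹ x u₁₂(b) ∈ N'` has first row `(1, x₀₁, x₀₂ + x₀₁ b)`. [cite: BernsteinZelevinskyASENS1977, §7.1] -/
theorem u12_inv_mul_mul_u12_eq {x : GL (Fin 3) F} (hx : x ∈ oppositeCellRadical (K := F) (lastBlockLabel 3)) (b : F) :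
    (transvectionGL (1 : Fin 3) 2 (show (1 : Fin 3) ≠ 2 by decide) b)⁻¹ * x * transvectionGL (1 : Fin 3) 2 (show (1 : Fin 3) ≠ 2 by decide) b =
      transvectionGL (0 : Fin 3) 1 (show (0 : Fin 3) ≠ 1 by decide) ((x : Matrix (Fin 3) (Fin 3) F) 0 1) *
        transvectionGL (0 : Fin 3) 2 (show (0 : Fin 3) ≠ 2 by decide) ((x : Matrix (Fin 3) (Fin 3) F) 0 2 + (x : Matrix (Fin 3) (Fin 3) F) 0 1 * b) := by
  conv_lhs => rw [eq_u01_mul_u02_of_mem hx]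
  exact u12_inv_mul_u01_mul_u02_mul_u12 b _ _

/-- First row of `u₀₁(y₁) u₀₂(y₂)`: `(1, y₁, y₂)`. [cite: BernsteinZelevinskyASENS1977, §7.1] -/
theorem u01_mul_u02_apply (y₁ y₂ : F) :
    ((transvectionGL (0 : Fin 3) 1 (show (0 : Fin 3) ≠ 1 by decide) y₁ * transvectionGL (0 : Fin 3) 2 (show (0 : Fin 3) ≠ 2 by decide) y₂ : GL (Fin 3) F) :
        Matrix (Fin 3) (Fin 3) F) 0 1 = y₁ ∧
      ((transvectionGL (0 : Fin 3) 1 (show (0 : Fin 3) ≠ 1 by decide) y₁ * transvectionGL (0 : Fin 3) 2 (show (0 : Fin 3) ≠ 2 by decide) y₂ : GL (Fin 3) F) :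
        Matrix (Fin 3) (Fin 3) F) 0 2 = y₂ := by
  simp [Units.val_mul, coe_transvectionGL, Matrix.transvection, Matrix.mul_apply, Fin.sum_univ_three]


/-! ## §2 The boxes `K(γ, γ·|t|⁻¹) = d_t K_γ d_t⁻¹ ≤ N'`, `d_t = diag(1,1,t)`, `K_γ = N' ∩ K_γ` -/

section Boxes

variable [ValuativeRel F]

/-- Membership in the standard box `K_γ = N' ∩ K_γ` (`γ < 1`): `v(x₀₁) ≤ γ` and `v(x₀₂) ≤ γ`.
[cite: BernsteinZelevinskyASENS1977, §7.1] -/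
theorem mem_box_iff {γ : ValueGroupWithZero F} (hγ : γ < 1)
    (x : ↥(oppositeCellRadical (K := F) (lastBlockLabel 3))) :
    x ∈ (congruenceGL 3 γ).comap (oppositeCellRadical (K := F) (lastBlockLabel 3)).subtype ↔
      valuation F (((x : GL (Fin 3) F) : Matrix (Fin 3) (Fin 3) F) 0 1) ≤ γ ∧
        valuation F (((x : GL (Fin 3) F) : Matrix (Fin 3) (Fin 3) F) 0 2) ≤ γ := by
  rw [Subgroup.mem_comap, Subgroup.coe_subtype,
    mem_congruenceGL_iff_of_mem_oppositeCellRadical (n := 1) hγ x.2]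
  constructor
  · intro h
    exact ⟨h 1 (by decide), h 2 (by decide)⟩
  · rintro ⟨h1, h2⟩ j hj
    fin_cases j
    · exact absurd rfl hj
    · exact h1
    · exact h2

/-- Membership in the conjugated box `d_t K_γ d_t⁻¹` (`d_t = diag(1,1,t)`): `v(x₀₁) ≤ γ` and `v(x₀₂ t) ≤ γ`.
[cite: BernsteinZelevinskyASENS1977, §7.1] -/
theorem mem_conjBox_iff {γ : ValueGroupWithZero F} (hγ : γ < 1) (t : Fˣ)
    (x : ↥(oppositeCellRadical (K := F) (lastBlockLabel 3))) :
    x ∈ conjSubgroup (diagGL_mem_standardParabolicGL (⇑OrderDual.toDual ∘ revLabel (lastBlockLabel 3))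
        (Function.update (1 : Fin 3 → Fˣ) 2 t))
        ((congruenceGL 3 γ).comap (oppositeCellRadical (K := F) (lastBlockLabel 3)).subtype) ↔
      valuation F (((x : GL (Fin 3) F) : Matrix (Fin 3) (Fin 3) F) 0 1) ≤ γ ∧
        valuation F (((x : GL (Fin 3) F) : Matrix (Fin 3) (Fin 3) F) 0 2 * (t : F)) ≤ γ := by
  rw [mem_conjSubgroup_iff, mem_box_iff hγ]
  simp only [coe_radicalConj_symm, coe_diagGL_inv_mul_mul_apply]
  have h0 : Function.update (1 : Fin 3 → Fˣ) 2 t 0 = 1 := by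
    rw [Function.update_of_ne (by decide), Pi.one_apply]
  have h1 : Function.update (1 : Fin 3 → Fˣ) 2 t 1 = 1 := by
    rw [Function.update_of_ne (by decide), Pi.one_apply]
  have h2 : Function.update (1 : Fin 3 → Fˣ) 2 t 2 = t := Function.update_self _ _ _
  rw [h0, h1, h2, inv_one, Units.val_one, one_mul, one_mul, mul_one]

/-- For `v(t) ≤ 1` the conjugated box contains the standard box. [cite: BernsteinZelevinskyASENS1977, §7.1] -/
theorem box_le_conjBox {γ : ValueGroupWithZero F} (hγ : γ < 1) {t : Fˣ} (ht : valuation F (t : F) ≤ 1) :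
    (congruenceGL 3 γ).comap (oppositeCellRadical (K := F) (lastBlockLabel 3)).subtype ≤
      conjSubgroup (diagGL_mem_standardParabolicGL (⇑OrderDual.toDual ∘ revLabel (lastBlockLabel 3))
        (Function.update (1 : Fin 3 → Fˣ) 2 t))
        ((congruenceGL 3 γ).comap (oppositeCellRadical (K := F) (lastBlockLabel 3)).subtype) := by
  intro x hx
  rw [mem_box_iff hγ] at hx
  rw [mem_conjBox_iff hγ]
  refine ⟨hx.1, ?_⟩
  rw [map_mul]
  exact mul_le_of_le_of_le_one hx.2 ht

/-- **Coset representatives in `U_P`**: every element of the conjugated box is `u₀₂(a) · ρ₁` with `ρ₁` in the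
standard box. [cite: BernsteinZelevinskyASENS1977, §7.1] -/
theorem exists_u02_mul_of_mem_conjBox {γ : ValueGroupWithZero F} (hγ : γ < 1) (t : Fˣ)
    {ρ : ↥(oppositeCellRadical (K := F) (lastBlockLabel 3))}
    (hρ : ρ ∈ conjSubgroup (diagGL_mem_standardParabolicGL (⇑OrderDual.toDual ∘ revLabel (lastBlockLabel 3))
        (Function.update (1 : Fin 3 → Fˣ) 2 t))
        ((congruenceGL 3 γ).comap (oppositeCellRadical (K := F) (lastBlockLabel 3)).subtype)) :
    ∃ (a : F) (ρ₁ : ↥(oppositeCellRadical (K := F) (lastBlockLabel 3))),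
      ρ₁ ∈ (congruenceGL 3 γ).comap (oppositeCellRadical (K := F) (lastBlockLabel 3)).subtype ∧
        (ρ : GL (Fin 3) F) = transvectionGL (0 : Fin 3) 2 (show (0 : Fin 3) ≠ 2 by decide) a * (ρ₁ : GL (Fin 3) F) := by
  rw [mem_conjBox_iff hγ] at hρ
  refine ⟨((ρ : GL (Fin 3) F) : Matrix (Fin 3) (Fin 3) F) 0 2,
    ⟨transvectionGL (0 : Fin 3) 1 (show (0 : Fin 3) ≠ 1 by decide) (((ρ : GL (Fin 3) F) : Matrix (Fin 3) (Fin 3) F) 0 1),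
      u0j_mem_oppositeCellRadical (show (0 : Fin 3) ≠ 1 by decide) _⟩, ?_, ?_⟩
  · rw [mem_box_iff hγ]
    refine ⟨?_, ?_⟩
    · change valuation F (((transvectionGL (0 : Fin 3) 1 (show (0 : Fin 3) ≠ 1 by decide) _ : GL (Fin 3) F) : Matrix (Fin 3) (Fin 3) F) 0 1) ≤ γ
      rw [coe_transvectionGL, Matrix.transvection, Matrix.add_apply, Matrix.one_apply_ne (show (0 : Fin 3) ≠ 1 by decide),
        Matrix.single_apply_same, zero_add]
      exact hρ.1
    · change valuation F (((transvectionGL (0 : Fin 3) 1 (show (0 : Fin 3) ≠ 1 by decide) _ : GL (Fin 3) F) : Matrix (Fin 3) (Fin 3) F) 0 2) ≤ γ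
      have e : ((transvectionGL (0 : Fin 3) 1 (show (0 : Fin 3) ≠ 1 by decide) (((ρ : GL (Fin 3) F) : Matrix (Fin 3) (Fin 3) F) 0 1) : GL (Fin 3) F) :
          Matrix (Fin 3) (Fin 3) F) 0 2 = 0 := by
        simp [coe_transvectionGL, Matrix.transvection]
      rw [e, map_zero]
      exact zero_le
  · change (ρ : GL (Fin 3) F) = transvectionGL (0 : Fin 3) 2 (show (0 : Fin 3) ≠ 2 by decide) _ * transvectionGL (0 : Fin 3) 1 (show (0 : Fin 3) ≠ 1 by decide) _
    rw [mul_comm_of_mem_oppositeCellRadical (n := 2) (u0j_mem_oppositeCellRadical (show (0 : Fin 3) ≠ 2 by decide) _)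
      (u0j_mem_oppositeCellRadical (show (0 : Fin 3) ≠ 1 by decide) _)]
    exact eq_u01_mul_u02_of_mem ρ.2

/-- **`u₁₂(b)` normalises the long box**: for `v(b t) ≤ 1`, `u₁₂(b) · K(γ, γ|t|⁻¹) · u₁₂(b)⁻¹ = K(γ, γ|t|⁻¹)`.
[cite: BernsteinZelevinskyASENS1977, §7.1] -/
theorem conjSubgroup_u12_conjBox {γ : ValueGroupWithZero F} (hγ : γ < 1) (t : Fˣ) {b : F}
    (hb : valuation F (b * (t : F)) ≤ 1) :
    conjSubgroup (u12_mem_reversedParabolic b)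
        (conjSubgroup (diagGL_mem_standardParabolicGL (⇑OrderDual.toDual ∘ revLabel (lastBlockLabel 3))
          (Function.update (1 : Fin 3 → Fˣ) 2 t))
          ((congruenceGL 3 γ).comap (oppositeCellRadical (K := F) (lastBlockLabel 3)).subtype)) =
      conjSubgroup (diagGL_mem_standardParabolicGL (⇑OrderDual.toDual ∘ revLabel (lastBlockLabel 3))
          (Function.update (1 : Fin 3 → Fˣ) 2 t))
        ((congruenceGL 3 γ).comap (oppositeCellRadical (K := F) (lastBlockLabel 3)).subtype) := by
  ext x
  rw [mem_conjSubgroup_iff, mem_conjBox_iff hγ, mem_conjBox_iff hγ, coe_radicalConj_symm,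
    u12_inv_mul_mul_u12_eq x.2 b, (u01_mul_u02_apply _ _).1, (u01_mul_u02_apply _ _).2]
  refine and_congr_right fun h1 => ?_
  have hb' : valuation F (((x : GL (Fin 3) F) : Matrix (Fin 3) (Fin 3) F) 0 1 * b * (t : F)) ≤ γ := by
    rw [mul_assoc, map_mul]
    exact mul_le_of_le_of_le_one h1 hb
  constructor
  · intro h
    have e : ((x : GL (Fin 3) F) : Matrix (Fin 3) (Fin 3) F) 0 2 * (t : F) =
        (((x : GL (Fin 3) F) : Matrix (Fin 3) (Fin 3) F) 0 2 + ((x : GL (Fin 3) F) : Matrix (Fin 3) (Fin 3) F) 0 1 * b) * (t : F) -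
          ((x : GL (Fin 3) F) : Matrix (Fin 3) (Fin 3) F) 0 1 * b * (t : F) := by ring
    rw [e]
    exact (Valuation.map_sub _ _ _).trans (max_le h hb')
  · intro h
    rw [add_mul]
    exact (Valuation.map_add _ _ _).trans (max_le h hb')

end Boxes


end Summit.HodgeConjecture.HodgeConjecture.R90.S1.SplitCell

end
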